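import Mathlib
import Summits.KontsevichZagierPeriods.Zeta5Search.AtlasRayX3
import Summits.KontsevichZagierPeriods.Zeta5Search.RayAtlasCellsX
import Summits.KontsevichZagierPeriods.Zeta5Search.Atlas.X3CellRP2
import Summits.KontsevichZagierPeriods.Zeta5Search.Atlas.X3CellRP3
import HarnessLib

/-!
# ζ(5) search — atlas machine, cell `X3CellR` of the ray `bX3Ray n` (part 4/4): `RayAtlas.X3CellR` (HONEST FRAMING: systematic search; no irrationality claim unless certified)

Cell `pub-zeta5`, P1 prover seat generation 8 (gap-filling rebuild of generation 7's machine: the parts of this cell landed by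
generation 7 are reused by name, the missing ones regenerated).  MACHINE-GENERATED by `code/gen/leangen.py` from the exact
scale-free class analysis `code/gen/raycell.py` (all odd `p` and all `n ≤ 150` in the cell sampled, 11325 instances; every
statement below is then PROVED, the atlas by `omega`).  Cell: `16 * n < p`, `p ≤ 18 * n`; level `m = -8`; class lengths `[3, 4]`;
bracket signatures per length `{3: 12, 4: 12}`; kind `origin-formal`
(level-`m` types: (1, -6, -3) (L=2); (-3, -6, 1) (L=2); (1, -4, -6, 1) (L=3); (1, -5, -5, 1) (L=3); (1, -6, -4, 1) (L=3)); bound `-12 = 3 + 2m + 1` from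
`CellKit.origin_bound`.  Valuations of rationals; nothing about irrationality.
-/

open Finset

namespace Summit.KontsevichZagierPeriods.Zeta5Search.Atlas.X3CellR

open Summit.KontsevichZagierPeriods.Zeta5Search.ClusterValuation (netExp classSet CentreIn classExp conjClass bRec)
open Summit.KontsevichZagierPeriods.Zeta5Search.CasoratianValuation (InPolytope shift casoratian)
open Summit.KontsevichZagierPeriods.Zeta5Search.CellKit
open Summit.KontsevichZagierPeriods.Zeta5Search.CellA (wHat vHat)
open Summit.KontsevichZagierPeriods.Zeta5Search.RayAtlas (bX1Ray bX2Ray bX3Ray)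
open Summit.KontsevichZagierPeriods.Zeta5Search.AtlasRayX3


variable {p : ℕ} [hp : Fact p.Prime]

/-- **`RayAtlas.X3CellR` IS A THEOREM** (`v_p(Cas₇) ≥ -12` on the cell; `origin-formal`, `m = -8`). -/
theorem holds : RayAtlas.X3CellR := by
  intro n p hn hprime hw h1 h2 hne
  haveI : Fact p.Prime := ⟨hprime⟩
  have hp5 : 5 ≤ p := by omega
  have hp2 : p % 2 = 1 := Nat.odd_iff.1 (hprime.odd_of_ne_two (by omega))
  rw [bX3Ray_eq_bLin] at hne ⊢
  have hb : InPolytope (bLin (14 * n) (15 * n) n) := inPolytope_bLin (by omega)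
  have hb' : InPolytope (shift (bLin (14 * n) (15 * n) n) 7) := inPolytope_shift_bLin (by omega) (by omega)
  have hwin : (bLin (14 * n) (15 * n) n 0 + 2 : ℤ) < (p : ℤ) ^ 2 := by
    have hw' : ((55 * n + 2 : ℕ) : ℤ) < ((p * p : ℕ) : ℤ) := by exact_mod_cast hw
    rw [b0_int]; push_cast at hw' ⊢; nlinarith [hw']
  have hpN : p ≤ ((bLin (14 * n) (15 * n) n) 0).toNat := by rw [b0_toNat]; omega
  have key := origin_bound (bLin (14 * n) (15 * n) n) hb (j := 7) (by norm_num) (by norm_num) hb' hp5 hwin hpN (m := -8) (by norm_num)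
    (fun x hx => exp_ge h1 h2 hp2 hx) (fun x hx hE => cen h1 h2 hp2 hx hE) (hcol h1 h2 hp2) hne
  linarith

end Summit.KontsevichZagierPeriods.Zeta5Search.Atlas.X3CellR
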